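import Mathlib
import Literature.MathematicalPhysics.QuantumFieldTheory.Balaban1983to89.B16Sect1Wilson
import Literature.MathematicalPhysics.QuantumFieldTheory.Balaban1983to89.B5Bounds167Lattice

/-!
# `Balaban1983to89.B16Ineq17Assembly` — [Balaban1989LargeFieldII] (1.7) p. 358 ASSEMBLED from its printed inputs:
(1.67) [10] BY NAME and the two perturbation steps of p. 357

T. Bałaban, *Large field renormalization. II. Localization, exponentiation, and bounds for the 𝐑 operation*, Commun.
Math. Phys. **122** (1989) 355–392 [Balaban1989LargeFieldII] (cell paper B16; PDF held
`paper:balaban1989-cmp122-large-field-ii`, journal page = PDF page + 354; pp. 357–358 = PDF 3–4, RE-READ AS IMAGES by this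
seat on the x2 renders `run/shared/lean/pub/pub-balaban/b2b-balaban-ref1/pages/1989-cmp122-large-field-II/…-p003-x2.png`,
`…-p004-x2.png`), with T. Bałaban, *Propagators and renormalization transformations for lattice gauge theories. I*,
Commun. Math. Phys. **95** (1984) 17–40 [Balaban1984PropagatorsI] (= [10] of the paper), (1.65)–(1.67) p. 29.

statement-level skeleton of published theorems with citation tags; proofs where landed; nothing here is a claim about
the Yang–Mills mass gap

CITATION HEADER / WHAT IS REPRODUCED.  Mega-formalization `lit-balaban`, HOME `run/shared/lean/pub/lit-balaban/`;
reader/typer **r13 gen 13** (B16 display-level owner; rows `lit-balaban-r13/ROWS-B16.md` v2.47).  SKELETON row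
**B16.Eq1.7** (owner r13): typed by r13 gen 1 as the leaf `B16Sect1Wilson.Ineq17 Q ndB nB γ₀ C M Rk εk :=
γ₀·ndB − C·(M⁶R_kε_k + e^{−R_k})·nB ≤ Q` (p238829) — over the value `Q` of the quadratic form
`⟨H_{1,k}B′, Δ₁(ζ₀)H_{1,k}B′⟩`, `ndB = ‖∂B′‖²`, `nB = ‖B′‖²`; r13's `SURVEY-B16-remaining.md` §B: *«(1.65)–(1.67) [10] = B5
(positivity of Δ_k for the k-th minimizer) + "replacing the minimizer … O(exp(−R_k))"»*.  The B5 side IS in the tree: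
row B5.Eq1.67 `B5.Bounds167` (typed verbatim, r02) is DISCHARGED BY NAME for the unit-torus family by r02's
`B5Bounds167Lattice.bounds167_formOfLattice` / `ineq167` (explicit `γ₀ = (4/π²)^{d+2}`).  This file assembles (1.7) from
exactly the inputs print names, consuming (1.67) BY NAME.

THE PRINT (p. 357 foot – p. 358 top [PDF 3–4], verbatim): *«Consider now the quadratic form in the exponential in (1.2).
This quadratic form is positive definite, and it is simple to estimate the lower bound.  At first, we apply the
construction of Sect. F [15] to the configuration U₀, and doing a proper gauge transformation we represent it on the
domain Z as exp iξA₀, with A₀ satisfying the bound |A₀|, |∇^ηA₀| < O(1)M⁶R_kε_k.  We also have to do the compensating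
adjoint gauge transformation on the variables B′.  Then we expand the expressions defining the quadratic form with
respect to A₀, up to the first order in A₀.  This was discussed in Sect. B [13].  The leading term in the expansion is
the quadratic form with the background field identically equal to 1.  Replacing the minimizer in this form by the kᵗʰ
minimizer defined on the whole lattice, and the function ζ₀ by the function identically equal to 1, we change the form
by a quadratic form bounded by O(exp(−R_k)).  Now the leading quadratic form is equal to ⟨B′, Δ_kB′⟩ defined by (1.65),
(1.66) [10].  Using the bound (1.67) [10] for this form, we obtain
⟨H_{1,k}B′, Δ₁(ζ₀)H_{1,k}B′⟩ ≧ γ₀‖∂B′‖² − O(1)(M⁶R_kε_k + exp(−R_k))‖B′‖².  (1.7)»*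

THE ASSEMBLY (exactly the printed three steps, as bookkeeping over the values of the forms at the fixed field `B′`):
`Q = Q_k + E_A + E_R` where `Q_k = ⟨B′, Δ_kB′⟩` is the leading form of [10], `E_A` the first-order error of the expansion in
`A₀` — *«bounded»* in the printed shape `|E_A| ≤ C₁·M⁶R_kε_k·‖B′‖²` (the size `O(1)M⁶R_kε_k` of `A₀` times the form
`‖B′‖²`; Sect. B [13]) — and `E_R` the replacement error, `|E_R| ≤ C₂·e^{−R_k}·‖B′‖²` (*«a quadratic form bounded by
O(exp(−R_k))»*); (1.67) [10] gives `Q_k ≥ γ₀‖∂B′‖²`; hence `Q ≥ γ₀‖∂B′‖² − (C₁M⁶R_kε_k + C₂e^{−R_k})‖B′‖² ≥ γ₀‖∂B′‖² −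
max(C₁,C₂)(M⁶R_kε_k + e^{−R_k})‖B′‖²` = (1.7) with `O(1) = max(C₁, C₂)`.

WHAT THIS FILE PROVES (kernel-checked, zero `sorry`, THEOREMS ONLY — no definition, no named fact; axioms standard;
BY NAME: `B16Sect1Wilson.Ineq17`/`Ineq18`/`Ineq19`/`ineq19_of_17_18` (r13 gen 1), `B5.Bounds167` (r02), r02's
`B5Bounds167Lattice.ineq167`/`formDk`/`d1Sq` — nothing re-proved).
§1 **`ineq17_of_inputs`** — `Ineq17 Q ndB nB γ₀ (max C₁ C₂) M Rk εk` from the splitting `Q = Q_k + E_A + E_R`, the two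
   printed-shape error letters and the instance `γ₀·ndB ≤ Q_k` of (1.67); `ineq17_of_pert` — the same with ONE combined
   perturbation letter `|Q − Q_k| ≤ C(M⁶R_kε_k + e^{−R_k})·nB`.
§2 **`ineq17_of_bounds167`** — (1.7) with (1.67) [10] CONSUMED BY NAME in its typed family form `B5.Bounds167 fam`
   (row B5.Eq1.67): ONE `γ₀ > 0` for the whole family such that, at every instance and field, the combined perturbation
   letter gives `Ineq17 Q (⟨∂B′,∂B′⟩) nB γ₀ C M Rk εk`.
§3 **`ineq17_lattice`** — (1.7) with the EXPLICIT `γ₀ = (4/π²)^{d+2}` of r02's unit-torus discharge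
   `B5Bounds167Lattice.ineq167` (`Q_k = formDk n M B′`, `ndB = d1Sq M B′` on `Tor M × Fin d → ℂ`).
§4 `ineq19_of_inputs` — (1.9) p. 358 from the same inputs + (1.8) (`Ineq18`) + print's «for g_k sufficiently small»
   made explicit, through r13 gen 1's `ineq19_of_17_18`.
HONEST SCOPE.  Located hypotheses, NOT discharged here (each a printed input of p. 357 in its printed shape, G.5-45 (ii)):
(a) the identification of the leading form with `⟨B′, Δ_kB′⟩` of (1.65)–(1.66) [10] after the first-order expansion in
`A₀` and the replacement of the minimizer/`ζ₀` (the splitting `hQ`); (b) the first-order expansion error bound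
`|E_A| ≤ C₁M⁶R_kε_k‖B′‖²` (Sect. F [15] representation `U₀ = exp iξA₀` with `|A₀|, |∇A₀| < O(1)M⁶R_kε_k` + Sect. B [13]);
(c) the replacement error `|E_R| ≤ C₂e^{−R_k}‖B′‖²` (exponential decay of the minimizer, R_k-separation).  (1.67) is
USED (row B5.Eq1.67: typed `B5.Bounds167`, discharged on the unit torus by r02), not re-proved.  The row's head stays
at the owner's call (the quadratic form `⟨H_{1,k}B′, Δ₁(ζ₀)H_{1,k}B′⟩` itself is not constructed here).  NOT summit
progress.
-/

namespace Literature.MathematicalPhysics.QuantumFieldTheory.Balaban1983to89.B16Ineq17Assembly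

open Literature.MathematicalPhysics.QuantumFieldTheory.Balaban1983to89
open B16Sect1Wilson

noncomputable section

/-! ## §1. (1.7) from the printed three steps (values of the forms at a fixed `B′`) -/

/-- **(1.7) p. 358 ASSEMBLED**: with the splitting `Q = Q_k + E_A + E_R` of the quadratic form
`Q = ⟨H_{1,k}B′, Δ₁(ζ₀)H_{1,k}B′⟩` into the leading form `Q_k = ⟨B′, Δ_kB′⟩` of (1.65)–(1.66) [10], the first-order
error `E_A` of the expansion in `A₀` (*«|A₀|, |∇^ηA₀| < O(1)M⁶R_kε_k … up to the first order in A₀ … Sect. B [13]»*: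
`|E_A| ≤ C₁M⁶R_kε_k·‖B′‖²`) and the replacement error `E_R` (*«we change the form by a quadratic form bounded by
O(exp(−R_k))»*: `|E_R| ≤ C₂e^{−R_k}·‖B′‖²`), the instance `γ₀‖∂B′‖² ≤ Q_k` of (1.67) [10] gives
`Ineq17 Q ‖∂B′‖² ‖B′‖² γ₀ (max C₁ C₂) M R_k ε_k`, i.e. (1.7) with `O(1) = max(C₁, C₂)`.
[cite: Balaban1989LargeFieldII, (1.7) pp.357–358; Balaban1984PropagatorsI, (1.67) p.29] -/
theorem ineq17_of_inputs {Q Qk EA ER ndB nB γ₀ C₁ C₂ M Rk εk : ℝ} (hQ : Q = Qk + EA + ER)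
    (h167 : γ₀ * ndB ≤ Qk) (hEA : |EA| ≤ C₁ * (M ^ 6 * Rk * εk) * nB)
    (hER : |ER| ≤ C₂ * Real.exp (-Rk) * nB) (hX : 0 ≤ M ^ 6 * Rk * εk) (hnB : 0 ≤ nB) :
    Ineq17 Q ndB nB γ₀ (max C₁ C₂) M Rk εk := by
  unfold Ineq17
  have hEA' : -(C₁ * (M ^ 6 * Rk * εk) * nB) ≤ EA := (abs_le.mp hEA).1
  have hER' : -(C₂ * Real.exp (-Rk) * nB) ≤ ER := (abs_le.mp hER).1
  have hexp : 0 ≤ Real.exp (-Rk) := (Real.exp_pos _).le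
  have h1 : C₁ * (M ^ 6 * Rk * εk) * nB ≤ max C₁ C₂ * (M ^ 6 * Rk * εk) * nB :=
    mul_le_mul_of_nonneg_right (mul_le_mul_of_nonneg_right (le_max_left _ _) hX) hnB
  have h2 : C₂ * Real.exp (-Rk) * nB ≤ max C₁ C₂ * Real.exp (-Rk) * nB :=
    mul_le_mul_of_nonneg_right (mul_le_mul_of_nonneg_right (le_max_right _ _) hexp) hnB
  have h3 : max C₁ C₂ * (M ^ 6 * Rk * εk + Real.exp (-Rk)) * nB =
      max C₁ C₂ * (M ^ 6 * Rk * εk) * nB + max C₁ C₂ * Real.exp (-Rk) * nB := by ring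
  rw [h3, hQ]
  linarith

/-- **(1.7) with ONE combined perturbation letter**: if the form differs from the leading form of [10] by at most
`C(M⁶R_kε_k + e^{−R_k})·‖B′‖²` (the two printed steps together) and (1.67) gives `γ₀‖∂B′‖² ≤ Q_k`, then
`Ineq17 Q ‖∂B′‖² ‖B′‖² γ₀ C M R_k ε_k`. [cite: Balaban1989LargeFieldII, (1.7) pp.357–358; Balaban1984PropagatorsI, (1.67) p.29] -/
theorem ineq17_of_pert {Q Qk ndB nB γ₀ C M Rk εk : ℝ} (h167 : γ₀ * ndB ≤ Qk)
    (hpert : |Q - Qk| ≤ C * (M ^ 6 * Rk * εk + Real.exp (-Rk)) * nB) : Ineq17 Q ndB nB γ₀ C M Rk εk := by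
  unfold Ineq17
  have h := (abs_le.mp hpert).1
  linarith

/-! ## §2. (1.7) with (1.67) [10] consumed BY NAME (`B5.Bounds167`) -/

/-- **(1.7) from (1.67) [10] BY NAME.**  For every family of form carriers satisfying r02's typed (1.67)
`B5.Bounds167 fam` (row B5.Eq1.67: `∃ γ₀ γ₁ > 0` uniform in the family with `γ₀⟨∂₁B,∂₁B⟩ ≤ ⟨B,Δ_kB⟩ ≤ γ₁⟨∂₁B,∂₁B⟩`),
there is ONE `γ₀ > 0` such that at every instance `i` and field `B′`, whenever the form `Q = ⟨H_{1,k}B′, Δ₁(ζ₀)H_{1,k}B′⟩`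
differs from the leading form `⟨B′, Δ_kB′⟩ = (fam i).formΔk B′` by at most `C(M⁶R_kε_k + e^{−R_k})·‖B′‖²` (the two printed
steps of p. 357), (1.7) holds: `Ineq17 Q ((fam i).d1Sq B′) ‖B′‖² γ₀ C M R_k ε_k`.
[cite: Balaban1989LargeFieldII, (1.7) pp.357–358; Balaban1984PropagatorsI, (1.67) p.29] -/
theorem ineq17_of_bounds167 {I : Type} {fam : I → B5.FormData} (h167 : B5.Bounds167 fam) :
    ∃ γ₀ : ℝ, 0 < γ₀ ∧ ∀ (i : I) (B : (fam i).Cfg) (Q C M Rk εk nB : ℝ),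
      |Q - (fam i).formΔk B| ≤ C * (M ^ 6 * Rk * εk + Real.exp (-Rk)) * nB →
        Ineq17 Q ((fam i).d1Sq B) nB γ₀ C M Rk εk := by
  obtain ⟨γ₀, γ₁, hγ₀, _hγ₁, h⟩ := h167
  exact ⟨γ₀, hγ₀, fun i B Q C M Rk εk nB hpert => ineq17_of_pert (h i B).1 hpert⟩

/-! ## §3. (1.7) with the explicit `γ₀` of the unit-torus discharge of (1.67) -/

/-- **(1.7) on the unit torus with r02's explicit constant.**  For the leading form `⟨B′, Δ_kB′⟩ = formDk n M B′` of
(1.66) [10] on the torus `T₁ = Π_μ ℤ/M_μ` at step `n = L^k ≥ 1` and `‖∂B′‖² = d1Sq M B′`, r02's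
`B5Bounds167Lattice.ineq167` gives (1.67) with `γ₀ = (4/π²)^{d+2}`; with the combined perturbation letter of p. 357 this
is (1.7): `Ineq17 Q (d1Sq M B′) ‖B′‖² ((4/π²)^{d+2}) C M R_k ε_k`.
[cite: Balaban1989LargeFieldII, (1.7) pp.357–358; Balaban1984PropagatorsI, (1.67) p.29] -/
theorem ineq17_lattice {d : ℕ} (n : ℕ) [NeZero n] (hn : 1 ≤ n) (Mt : Fin d → ℕ) [∀ μ, NeZero (Mt μ)]
    (B : B5Prop11Plancherel.Tor Mt × Fin d → ℂ) {Q C M Rk εk nB : ℝ}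
    (hpert : |Q - B5Bounds167Lattice.formDk n Mt B| ≤ C * (M ^ 6 * Rk * εk + Real.exp (-Rk)) * nB) :
    Ineq17 Q (B5Bounds167Lattice.d1Sq Mt B) nB ((4 / Real.pi ^ 2) ^ (d + 2)) C M Rk εk :=
  ineq17_of_pert (B5Bounds167Lattice.ineq167 n Mt hn B).1 hpert

/-! ## §4. (1.9) from the same inputs -/

/-- **(1.9) p. 358 from the printed inputs of (1.7) and (1.8)**: the (1.67)-instance `γ₀‖∂B′‖² ≤ Q_k`, the combined
perturbation letter, (1.8) `Ineq18 ‖B′‖² ‖∂B′‖² d M` and print's *«for g_k sufficiently small»* made explicit as in r13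
gen 1's `ineq19_of_17_18` (`C(M⁶R_kε_k + e^{−R_k}) ≤ γ₀/(2d(100M)^{d+1})`) give
`⟨H_{1,k}B′, Δ₁(ζ₀)H_{1,k}B′⟩ ≥ γ₀/(2d(100M)^{d+1})·‖B′‖²`. [cite: Balaban1989LargeFieldII, (1.9) p.358; Balaban1984PropagatorsI, (1.67) p.29] -/
theorem ineq19_of_inputs {Q Qk ndB nB γ₀ C M Rk εk : ℝ} {d : ℕ} (hd : 1 ≤ d) (hM : 0 < M) (hγ : 0 ≤ γ₀)
    (hnB : 0 ≤ nB) (h167 : γ₀ * ndB ≤ Qk) (hpert : |Q - Qk| ≤ C * (M ^ 6 * Rk * εk + Real.exp (-Rk)) * nB)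
    (h18 : Ineq18 nB ndB d M) (hsmall : C * (M ^ 6 * Rk * εk + Real.exp (-Rk)) ≤ γ₀ / (2 * d * (100 * M) ^ (d + 1))) :
    Ineq19 Q nB γ₀ d M :=
  ineq19_of_17_18 hd hM hγ hnB (ineq17_of_pert h167 hpert) h18 hsmall

end

end Literature.MathematicalPhysics.QuantumFieldTheory.Balaban1983to89.B16Ineq17Assembly
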